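import Mathlib
import HarnessLib
import Summits.Ventures.LatticeQCDFlow.Exactness.U1MultiStepLeapfrogHMCErgodic
import Summits.Ventures.LatticeQCDFlow.Exactness.NCMCGeneralSpaceDoeblinPowerCLT
import Summits.Ventures.LatticeQCDFlow.Scoring.DoeblinPowerBatchMeansCLT
import Summits.Ventures.LatticeQCDFlow.Scoring.DoeblinPowerBatchMeansTauInt

/-!
# The `u1_2d` engine's `n`-step leapfrog HMC on `U(1)` lattice gauge fields (short trajectories): its one-step Doeblin certificate, every event a finite `τ_int`, certified burn-in, the CLT and asymptotically exact batch-means error bars from EVERY start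

HONEST FRAMING: exact (Metropolis-corrected) sampling algorithms for lattice gauge theory;
figures of merit are autocorrelation/cost numbers at stated couplings and volumes; no
continuum-physics claim.

Venture `LatticeQCDFlow` (cell pub-lqcd), topic `Exactness`, FANOUT row 9 (eng-latcore, GEN-23; the engine
`latflow.core.u1_2d.U1Field2D.hmc_trajectory(β, τ, nstep)` — STEP-0 of the ladder, the 2D `U(1)` comparator of the
flow samplers).  NEW WORK of the cell over the tree, nothing cited as a fact, no number claimed: gen-17's
`U1MultiStepLeapfrogHMC.lean` / `U1MultiStepLeapfrogHMCErgodic.lean` (`u1LeapfrogHMCN`, `u1LeapfrogHMCN_minorised` —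
ONE-STEP Doeblin `δ · Haar^{⊗E} ≤ K_n(U, ·)` for `4 K ε n² ≤ 3`, `u1LeapfrogHMCN_invariant_gibbsLaw`,
`wilson_u1LeapfrogHMCN_uniformlyErgodic` — convergence only), `U1LeapfrogHMCWilson.lean` (`u1GibbsLaw_eq_wilsonMeasure`,
`exists_bound_smul_wilsonAction_circle`), rows 13 / 8 (`…_of_nHit` consequences).  Row 8's
`Scoring/WilsonMetropolisSweepBatchMeans.lean` is the `u1_2d` METROPOLIS sweep; this file is its HMC.  Printed
counterparts NAMED ONLY: Duane–Kennedy–Pendleton–Roweth 1987; Meyn–Tweedie 1993; Flegal–Jones 2010; Madras–Sokal 1988.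

## Content (torus `(ℤ/L)^d`, `G = U(1)`, continuous representation `ρ`, any real `β`; `n ≥ 1` P-first leapfrog
## steps of size `ε > 0`, Gaussian momenta (`κ > 0`), a measurable `K`-Lipschitz increment `g` bounded by `b ≥ 0`
## with `4 K ε n² ≤ 3` (short trajectories), Metropolis test; `K_n = u1LeapfrogHMCN ε κ g (β S_W) n`,
## `π = wilsonMeasure ρ β`)

* **`wilson_u1LeapfrogHMCN_certificate`** — `K_n` leaves `π` invariant and `ε' • Haar^{⊗E} ≤ K_n(U, ·) = K_n^1(U, ·)`
  for EVERY `U`, `0 < ε' ≤ 1`.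
* **`wilson_u1LeapfrogHMCN_tauInt_setACF_le`** (ONE `B`: `τ_int(1_A) ≤ 1/2 + B/(1 − π(A))` for EVERY event —
  a topological sector of the 2D `U(1)` theory, say), **`wilson_u1LeapfrogHMCN_timeAverage_bias_le`** (burn-in
  `B/N'` from EVERY start), **`wilson_u1LeapfrogHMCN_timeAverage_clt`**, **`wilson_u1LeapfrogHMCN_batchMeans_tendstoInMeasure`**,
  **`wilson_u1LeapfrogHMCN_batchMeans_coverage`** (`σ²_f > 0`), **`wilson_u1LeapfrogHMCN_tauInt_tendstoInMeasure`**
  (`Var_π f ≠ 0`).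

NOT CLAIMED: anything for `4 K ε n² > 3` (long trajectories; the `u1_2d` free-field resonance of row 2 shows the
restriction is not an artefact); any value of `ε', B`; the identification `g = −ε·∂(βS_W)` with its Lipschitz
constant (row 9's `U1WilsonForceLipschitz.lean` supplies it; not instantiated here); floating point.
-/

noncomputable section

namespace Summit.Ventures.LatticeQCDFlow.Exactness

open MeasureTheory ProbabilityTheory Set Function Filter Topology
open Literature.MathematicalPhysics.QuantumFieldTheory
open Summit.Ventures.LatticeQCDFlow.Scoring (replicaSEsq tauInt autocov kop)
open scoped ENNReal NNReal

section U1HMC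

variable {d L N : ℕ} (ρ : Circle →* Matrix (Fin N) (Fin N) ℂ)

/-- **THE ONE-STEP DOEBLIN CERTIFICATE OF THE `u1_2d` ENGINE'S `n`-STEP LEAPFROG HMC** (short trajectories): the
kernel leaves `wilsonMeasure ρ β` invariant and dominates `ε' · Haar^{⊗E}` from EVERY configuration in ONE step,
`0 < ε' ≤ 1`. -/
theorem wilson_u1LeapfrogHMCN_certificate [NeZero L] (hρ : Continuous ρ) (β : ℝ) {ε κ : ℝ}
    (hε : 0 < ε) (hκ : 0 < κ) {n : ℕ} (hn : 1 ≤ n)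
    {g : GaugeConfig d L Circle → Edge d L → ℝ} (hg : Measurable g) {K : ℝ≥0}
    (hgK : LipschitzWith K g) (hshort : 4 * (K : ℝ) * ε * (n : ℝ) ^ 2 ≤ 3)
    {b : ℝ} (hb0 : 0 ≤ b) (hb : ∀ U e, ‖g U e‖ ≤ b) :
    Kernel.Invariant (u1LeapfrogHMCN ε κ hg (fun U : GaugeConfig d L Circle => β * wilsonAction ρ U) n) (wilsonMeasure (d := d) (L := L) ρ β) ∧
      ∃ ε' : ℝ≥0∞, 0 < ε' ∧ ε' ≤ 1 ∧ ∀ U : GaugeConfig d L Circle,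
        ε' • Measure.pi (fun _ : Edge d L => haarProbability Circle) ≤ nHit (u1LeapfrogHMCN ε κ hg (fun U : GaugeConfig d L Circle => β * wilsonAction ρ U) n) 1 U := by
  haveI : Fact (0 < κ) := ⟨hκ⟩
  obtain ⟨s, hs⟩ := exists_bound_smul_wilsonAction_circle (d := d) (L := L) ρ hρ β
  have hS : Measurable fun U : GaugeConfig d L Circle => β * wilsonAction ρ U := (continuous_smul_wilsonAction ρ hρ β).measurable
  obtain ⟨δ, hδ0, hmin⟩ := u1LeapfrogHMCN_minorised hε hκ hn hg hgK hshort hb0 hb hS hs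
  have hH : Measurable fun z : (GaugeConfig d L Circle) × (Edge d L → ℝ) => β * wilsonAction ρ z.1 + u1Kinetic κ z.2 :=
    (hS.comp measurable_fst).add ((measurable_u1Kinetic κ).comp measurable_snd)
  haveI : Fact (Measurable fun z : (GaugeConfig d L Circle) × (Edge d L → ℝ) => β * wilsonAction ρ z.1 + u1Kinetic κ z.2) := ⟨hH⟩
  haveI : IsMarkovKernel (u1LeapfrogHMCN ε κ hg (fun U : GaugeConfig d L Circle => β * wilsonAction ρ U) n) := by
    unfold u1LeapfrogHMCN; infer_instance
  have hδ1 : δ ≤ 1 := by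
    have h := Measure.le_iff'.1 (hmin fun _ => 1) univ
    rwa [Measure.smul_apply, smul_eq_mul, measure_univ, measure_univ, mul_one] at h
  have hinv : Kernel.Invariant (u1LeapfrogHMCN ε κ hg (fun U : GaugeConfig d L Circle => β * wilsonAction ρ U) n) (wilsonMeasure (d := d) (L := L) ρ β) := by
    rw [← u1GibbsLaw_eq_wilsonMeasure (d := d) (L := L) ρ β]
    exact u1LeapfrogHMCN_invariant_gibbsLaw hκ hg hS n
  refine ⟨hinv, δ, hδ0, hδ1, fun U => ?_⟩
  rw [GeneralNCMC.nHit_one]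
  exact hmin U

omit ρ in
/-- The `U(1)` Wilson measure is a probability law (continuous `ρ`). -/
theorem isProbabilityMeasure_wilsonMeasure_circle [NeZero L] (ρ : Circle →* Matrix (Fin N) (Fin N) ℂ)
    (hρ : Continuous ρ) (β : ℝ) : IsProbabilityMeasure (wilsonMeasure (d := d) (L := L) ρ β) :=
  isProbabilityMeasure_wilsonMeasure _ hρ β

/-! ## Figures of merit: `τ_int` of every event, burn-in, CLT, batch means, coverage, `τ̂_int` -/

/-- **EVERY EVENT HAS A FINITE `τ_int` UNDER THE `u1_2d` LEAPFROG HMC — ONE CONSTANT FOR ALL EVENTS**: `B ≥ 0` with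
`τ_int(1_A) ≤ 1/2 + B/(1 − π(A))` (scorers' `Scoring.tauInt`) for EVERY measurable `A` with `0 < π(A) < 1`. -/
theorem wilson_u1LeapfrogHMCN_tauInt_setACF_le [NeZero L] (hρ : Continuous ρ) (β : ℝ) {ε κ : ℝ}
    (hε : 0 < ε) (hκ : 0 < κ) {n : ℕ} (hn : 1 ≤ n)
    {g : GaugeConfig d L Circle → Edge d L → ℝ} (hg : Measurable g) {K : ℝ≥0}
    (hgK : LipschitzWith K g) (hshort : 4 * (K : ℝ) * ε * (n : ℝ) ^ 2 ≤ 3)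
    {b : ℝ} (hb0 : 0 ≤ b) (hb : ∀ U e, ‖g U e‖ ≤ b)
    [IsMarkovKernel (u1LeapfrogHMCN ε κ hg (fun U : GaugeConfig d L Circle => β * wilsonAction ρ U) n)] :
    ∃ B : ℝ, 0 ≤ B ∧ ∀ A : Set (GaugeConfig d L Circle), MeasurableSet A →
      0 < (wilsonMeasure (d := d) (L := L) ρ β).real A → (wilsonMeasure (d := d) (L := L) ρ β).real A < 1 →
      tauInt (setACF (u1LeapfrogHMCN ε κ hg (fun U : GaugeConfig d L Circle => β * wilsonAction ρ U) n)
          (wilsonMeasure (d := d) (L := L) ρ β) A) ≤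
        1 / 2 + B / (1 - (wilsonMeasure (d := d) (L := L) ρ β).real A) := by
  haveI := isProbabilityMeasure_wilsonMeasure_circle (d := d) (L := L) ρ hρ β
  obtain ⟨hinv, ε', hε0, hε1, hmin⟩ := wilson_u1LeapfrogHMCN_certificate (d := d) (L := L) ρ hρ β hε hκ hn hg hgK hshort hb0 hb
  have he0 : 0 < ε'.toReal := ENNReal.toReal_pos hε0.ne' (ne_top_of_le_ne_top ENNReal.one_ne_top hε1)
  have he1 : ε'.toReal ≤ 1 := ENNReal.toReal_le_of_le_ofReal zero_le_one (by simpa using hε1)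
  refine ⟨1 / ε'.toReal - 1, ?_, fun A hA h0 h1 => ?_⟩
  · rw [sub_nonneg, le_div_iff₀ he0]; nlinarith
  · simpa using GeneralNCMC.tauInt_setACF_le_of_nHit (GeneralNCMC.minorised_setwise hmin) hε0 hε1
      Nat.one_pos hinv hA h0 h1

/-- **CERTIFIED BURN-IN OF THE `u1_2d` LEAPFROG HMC FROM EVERY START**: one `B ≥ 0` with
`|E_{μ₀}[(1/N') Σ_{t<N'} q(U_t)] − ∫ q dπ| ≤ B/N'` for EVERY initial law, every `[0,1]`-valued measurable `q`, `N' ≥ 1`. -/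
theorem wilson_u1LeapfrogHMCN_timeAverage_bias_le [NeZero L] (hρ : Continuous ρ) (β : ℝ) {ε κ : ℝ}
    (hε : 0 < ε) (hκ : 0 < κ) {n : ℕ} (hn : 1 ≤ n)
    {g : GaugeConfig d L Circle → Edge d L → ℝ} (hg : Measurable g) {K : ℝ≥0}
    (hgK : LipschitzWith K g) (hshort : 4 * (K : ℝ) * ε * (n : ℝ) ^ 2 ≤ 3)
    {b : ℝ} (hb0 : 0 ≤ b) (hb : ∀ U e, ‖g U e‖ ≤ b)
    [IsMarkovKernel (u1LeapfrogHMCN ε κ hg (fun U : GaugeConfig d L Circle => β * wilsonAction ρ U) n)] :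
    ∃ B : ℝ, 0 ≤ B ∧ ∀ (μ₀ : Measure (GaugeConfig d L Circle)) [IsProbabilityMeasure μ₀]
      (q : GaugeConfig d L Circle → ℝ), Measurable q → (∀ U, 0 ≤ q U) → (∀ U, q U ≤ 1) →
      ∀ N' : ℕ, N' ≠ 0 →
      |∫ x, (∑ t ∈ Finset.range N', q (x t)) / N'
          ∂(Kernel.trajMeasure (X := fun _ : ℕ => GaugeConfig d L Circle) μ₀
              (fun t : ℕ => (u1LeapfrogHMCN ε κ hg (fun U : GaugeConfig d L Circle => β * wilsonAction ρ U) n).comap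
                (fun h : (i : ↥(Finset.Iic t)) → GaugeConfig d L Circle =>
                  h ⟨t, Finset.mem_Iic.2 le_rfl⟩) (measurable_pi_apply _)))
        - ∫ U, q U ∂(wilsonMeasure (d := d) (L := L) ρ β)| ≤ B / N' := by
  haveI := isProbabilityMeasure_wilsonMeasure_circle (d := d) (L := L) ρ hρ β
  obtain ⟨hinv, ε', hε0, hε1, hmin⟩ := wilson_u1LeapfrogHMCN_certificate (d := d) (L := L) ρ hρ β hε hκ hn hg hgK hshort hb0 hb
  have he0 : 0 < ε'.toReal := ENNReal.toReal_pos hε0.ne' (ne_top_of_le_ne_top ENNReal.one_ne_top hε1)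
  refine ⟨1 / ε'.toReal, by positivity, fun μ₀ _ q hq h0 h1 N' hN => ?_⟩
  calc _ ≤ ((1 : ℕ) : ℝ) / (ε'.toReal * N') :=
        GeneralNCMC.chain_timeAverage_bias_le_of_nHit (GeneralNCMC.minorised_setwise hmin) hε0 hε1 Nat.one_pos
          hinv μ₀ hq h0 h1 hN
    _ = 1 / ε'.toReal / N' := by rw [Nat.cast_one, div_div]

/-- **THE CLT FOR TIME AVERAGES OF THE `u1_2d` LEAPFROG HMC, FROM EVERY INITIAL LAW** (`|f| ≤ C` measurable,
`Y ~ N(0, σ²_f)`): `(√N')⁻¹ Σ_{t<N'} (f(U_t) − π f) ⇒ Y` under `P_{μ₀}`. -/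
theorem wilson_u1LeapfrogHMCN_timeAverage_clt [NeZero L] (hρ : Continuous ρ) (β : ℝ) {ε κ : ℝ}
    (hε : 0 < ε) (hκ : 0 < κ) {n : ℕ} (hn : 1 ≤ n)
    {g : GaugeConfig d L Circle → Edge d L → ℝ} (hg : Measurable g) {K : ℝ≥0}
    (hgK : LipschitzWith K g) (hshort : 4 * (K : ℝ) * ε * (n : ℝ) ^ 2 ≤ 3)
    {b : ℝ} (hb0 : 0 ≤ b) (hb : ∀ U e, ‖g U e‖ ≤ b)
    [IsMarkovKernel (u1LeapfrogHMCN ε κ hg (fun U : GaugeConfig d L Circle => β * wilsonAction ρ U) n)]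
    {f : GaugeConfig d L Circle → ℝ} (hf : Measurable f) {C : ℝ} (hC : ∀ U, |f U| ≤ C)
    (μ₀ : Measure (GaugeConfig d L Circle)) [IsProbabilityMeasure μ₀]
    [IsProbabilityMeasure (Kernel.trajMeasure (X := fun _ : ℕ => GaugeConfig d L Circle) μ₀
              (fun t : ℕ => (u1LeapfrogHMCN ε κ hg (fun U : GaugeConfig d L Circle => β * wilsonAction ρ U) n).comap
                (fun h : (i : ↥(Finset.Iic t)) → GaugeConfig d L Circle =>
                  h ⟨t, Finset.mem_Iic.2 le_rfl⟩) (measurable_pi_apply _)))]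
    {Ω' : Type*} [MeasurableSpace Ω'] {P' : Measure Ω'} [IsProbabilityMeasure P'] {Y : Ω' → ℝ}
    (hY : HasLaw Y (gaussianReal 0 (Real.toNNReal
      ((∫ y, (f y - ∫ z, f z ∂(wilsonMeasure (d := d) (L := L) ρ β)) ^ 2 ∂(wilsonMeasure (d := d) (L := L) ρ β))
              + 2 * ∑' k, ∫ y, (f y - ∫ z, f z ∂(wilsonMeasure (d := d) (L := L) ρ β))
                * (kop (u1LeapfrogHMCN ε κ hg (fun U : GaugeConfig d L Circle => β * wilsonAction ρ U) n))^[k + 1]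
                  (fun y => f y - ∫ z, f z ∂(wilsonMeasure (d := d) (L := L) ρ β)) y ∂(wilsonMeasure (d := d) (L := L) ρ β)))) P') :
    TendstoInDistribution (fun (N' : ℕ) (x : ℕ → GaugeConfig d L Circle) =>
        (Real.sqrt N')⁻¹ * ∑ t ∈ Finset.range N', (f (x t) - ∫ z, f z ∂(wilsonMeasure (d := d) (L := L) ρ β)))
      atTop Y (fun _ => (Kernel.trajMeasure (X := fun _ : ℕ => GaugeConfig d L Circle) μ₀
              (fun t : ℕ => (u1LeapfrogHMCN ε κ hg (fun U : GaugeConfig d L Circle => β * wilsonAction ρ U) n).comap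
                (fun h : (i : ↥(Finset.Iic t)) → GaugeConfig d L Circle =>
                  h ⟨t, Finset.mem_Iic.2 le_rfl⟩) (measurable_pi_apply _)))) P' := by
  haveI := isProbabilityMeasure_wilsonMeasure_circle (d := d) (L := L) ρ hρ β
  obtain ⟨hinv, ε', hε0, -, hmin⟩ := wilson_u1LeapfrogHMCN_certificate (d := d) (L := L) ρ hρ β hε hκ hn hg hgK hshort hb0 hb
  exact GeneralNCMC.tendstoInDistribution_timeAverage_of_nHit hinv hε0.ne' hmin Nat.one_pos hf hC μ₀ hY

/-- **BATCH MEANS ESTIMATE `σ²_f` CONSISTENTLY ALONG THE `u1_2d` LEAPFROG HMC, FROM EVERY INITIAL LAW.** -/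
theorem wilson_u1LeapfrogHMCN_batchMeans_tendstoInMeasure [NeZero L] (hρ : Continuous ρ) (β : ℝ) {ε κ : ℝ}
    (hε : 0 < ε) (hκ : 0 < κ) {n : ℕ} (hn : 1 ≤ n)
    {g : GaugeConfig d L Circle → Edge d L → ℝ} (hg : Measurable g) {K : ℝ≥0}
    (hgK : LipschitzWith K g) (hshort : 4 * (K : ℝ) * ε * (n : ℝ) ^ 2 ≤ 3)
    {b : ℝ} (hb0 : 0 ≤ b) (hb : ∀ U e, ‖g U e‖ ≤ b)
    [IsMarkovKernel (u1LeapfrogHMCN ε κ hg (fun U : GaugeConfig d L Circle => β * wilsonAction ρ U) n)]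
    {f : GaugeConfig d L Circle → ℝ} (hf : Measurable f) {C : ℝ} (hC : ∀ U, |f U| ≤ C)
    (μ₀ : Measure (GaugeConfig d L Circle)) [IsProbabilityMeasure μ₀]
    {a b' : ℕ → ℕ} (ha : Tendsto a atTop atTop) (hb' : Tendsto b' atTop atTop) :
    TendstoInMeasure (Kernel.trajMeasure (X := fun _ : ℕ => GaugeConfig d L Circle) μ₀
              (fun t : ℕ => (u1LeapfrogHMCN ε κ hg (fun U : GaugeConfig d L Circle => β * wilsonAction ρ U) n).comap
                (fun h : (i : ↥(Finset.Iic t)) → GaugeConfig d L Circle =>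
                  h ⟨t, Finset.mem_Iic.2 le_rfl⟩) (measurable_pi_apply _)))
      (fun (N' : ℕ) (x : ℕ → GaugeConfig d L Circle) => ((b' N' * a N' : ℕ) : ℝ)
        * replicaSEsq (fun j (x : ℕ → GaugeConfig d L Circle) =>
            (∑ i ∈ Finset.range (b' N'), f (x (b' N' * j + i))) / (b' N')) (a N') x)
      atTop (fun _ => (∫ y, (f y - ∫ z, f z ∂(wilsonMeasure (d := d) (L := L) ρ β)) ^ 2 ∂(wilsonMeasure (d := d) (L := L) ρ β))
              + 2 * ∑' k, ∫ y, (f y - ∫ z, f z ∂(wilsonMeasure (d := d) (L := L) ρ β))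
                * (kop (u1LeapfrogHMCN ε κ hg (fun U : GaugeConfig d L Circle => β * wilsonAction ρ U) n))^[k + 1]
                  (fun y => f y - ∫ z, f z ∂(wilsonMeasure (d := d) (L := L) ρ β)) y ∂(wilsonMeasure (d := d) (L := L) ρ β)) := by
  haveI := isProbabilityMeasure_wilsonMeasure_circle (d := d) (L := L) ρ hρ β
  obtain ⟨hinv, ε', hε0, hε1, hmin⟩ := wilson_u1LeapfrogHMCN_certificate (d := d) (L := L) ρ hρ β hε hκ hn hg hgK hshort hb0 hb
  exact Scoring.chain_batchMeans_sigmaHat_tendstoInMeasure_of_nHit hinv (GeneralNCMC.minorised_setwise hmin)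
    hε0 hε1 Nat.one_pos hf hC μ₀ ha hb'

/-- **THE BATCH-MEANS INTERVAL OF A `u1_2d` HMC RUN IS ASYMPTOTICALLY EXACT** (`σ²_f > 0`, any initial law,
`z > 0`): `P_{μ₀}(|√(ab) (f̄_{ab} − π f)| ≤ z σ̂_BM) → (gaussianReal 0 1)[−z, z]`. -/
theorem wilson_u1LeapfrogHMCN_batchMeans_coverage [NeZero L] (hρ : Continuous ρ) (β : ℝ) {ε κ : ℝ}
    (hε : 0 < ε) (hκ : 0 < κ) {n : ℕ} (hn : 1 ≤ n)
    {g : GaugeConfig d L Circle → Edge d L → ℝ} (hg : Measurable g) {K : ℝ≥0}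
    (hgK : LipschitzWith K g) (hshort : 4 * (K : ℝ) * ε * (n : ℝ) ^ 2 ≤ 3)
    {b : ℝ} (hb0 : 0 ≤ b) (hb : ∀ U e, ‖g U e‖ ≤ b)
    [IsMarkovKernel (u1LeapfrogHMCN ε κ hg (fun U : GaugeConfig d L Circle => β * wilsonAction ρ U) n)]
    {f : GaugeConfig d L Circle → ℝ} (hf : Measurable f) {C : ℝ} (hC : ∀ U, |f U| ≤ C)
    (hσ : 0 < (∫ y, (f y - ∫ z, f z ∂(wilsonMeasure (d := d) (L := L) ρ β)) ^ 2 ∂(wilsonMeasure (d := d) (L := L) ρ β))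
              + 2 * ∑' k, ∫ y, (f y - ∫ z, f z ∂(wilsonMeasure (d := d) (L := L) ρ β))
                * (kop (u1LeapfrogHMCN ε κ hg (fun U : GaugeConfig d L Circle => β * wilsonAction ρ U) n))^[k + 1]
                  (fun y => f y - ∫ z, f z ∂(wilsonMeasure (d := d) (L := L) ρ β)) y ∂(wilsonMeasure (d := d) (L := L) ρ β))
    (μ₀ : Measure (GaugeConfig d L Circle)) [IsProbabilityMeasure μ₀]
    {a b' : ℕ → ℕ} (ha : Tendsto a atTop atTop) (hb' : Tendsto b' atTop atTop) {z : ℝ} (hz : 0 < z) :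
    Tendsto (fun N' : ℕ => (Kernel.trajMeasure (X := fun _ : ℕ => GaugeConfig d L Circle) μ₀
              (fun t : ℕ => (u1LeapfrogHMCN ε κ hg (fun U : GaugeConfig d L Circle => β * wilsonAction ρ U) n).comap
                (fun h : (i : ↥(Finset.Iic t)) → GaugeConfig d L Circle =>
                  h ⟨t, Finset.mem_Iic.2 le_rfl⟩) (measurable_pi_apply _))).real
      {x | |((Real.sqrt ((b' N' * a N' : ℕ) : ℝ))⁻¹
          * ∑ t ∈ Finset.range (b' N' * a N'), (f (x t) - ∫ z, f z ∂(wilsonMeasure (d := d) (L := L) ρ β)))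
        / Real.sqrt (((b' N' * a N' : ℕ) : ℝ)
          * replicaSEsq (fun j (x : ℕ → GaugeConfig d L Circle) =>
              (∑ i ∈ Finset.range (b' N'), f (x (b' N' * j + i))) / (b' N')) (a N') x)| ≤ z})
      atTop (𝓝 ((gaussianReal 0 1).real (Set.Icc (-z) z))) := by
  haveI := isProbabilityMeasure_wilsonMeasure_circle (d := d) (L := L) ρ hρ β
  obtain ⟨hinv, ε', hε0, hε1, hmin⟩ := wilson_u1LeapfrogHMCN_certificate (d := d) (L := L) ρ hρ β hε hκ hn hg hgK hshort hb0 hb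
  exact Scoring.doeblinPower_batchMeans_studentized_coverage hinv hmin hε0 hε1 Nat.one_pos hf hC hσ μ₀ ha hb' hz

/-- **THE REPORTED `τ̂_int = σ̂²_BM/(2 v̂)` OF A `u1_2d` HMC RUN IS CONSISTENT** (`Var_π f ≠ 0`, any initial law). -/
theorem wilson_u1LeapfrogHMCN_tauInt_tendstoInMeasure [NeZero L] (hρ : Continuous ρ) (β : ℝ) {ε κ : ℝ}
    (hε : 0 < ε) (hκ : 0 < κ) {n : ℕ} (hn : 1 ≤ n)
    {g : GaugeConfig d L Circle → Edge d L → ℝ} (hg : Measurable g) {K : ℝ≥0}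
    (hgK : LipschitzWith K g) (hshort : 4 * (K : ℝ) * ε * (n : ℝ) ^ 2 ≤ 3)
    {b : ℝ} (hb0 : 0 ≤ b) (hb : ∀ U e, ‖g U e‖ ≤ b)
    [IsMarkovKernel (u1LeapfrogHMCN ε κ hg (fun U : GaugeConfig d L Circle => β * wilsonAction ρ U) n)]
    {f : GaugeConfig d L Circle → ℝ} (hf : Measurable f) {C : ℝ} (hC : ∀ U, |f U| ≤ C)
    (hvar : autocov (u1LeapfrogHMCN ε κ hg (fun U : GaugeConfig d L Circle => β * wilsonAction ρ U) n)
        (wilsonMeasure (d := d) (L := L) ρ β) (fun y => f y - ∫ z, f z ∂(wilsonMeasure (d := d) (L := L) ρ β)) 0 ≠ 0)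
    (μ₀ : Measure (GaugeConfig d L Circle)) [IsProbabilityMeasure μ₀]
    {a b' : ℕ → ℕ} (ha : Tendsto a atTop atTop) (hb' : Tendsto b' atTop atTop) :
    TendstoInMeasure (Kernel.trajMeasure (X := fun _ : ℕ => GaugeConfig d L Circle) μ₀
              (fun t : ℕ => (u1LeapfrogHMCN ε κ hg (fun U : GaugeConfig d L Circle => β * wilsonAction ρ U) n).comap
                (fun h : (i : ↥(Finset.Iic t)) → GaugeConfig d L Circle =>
                  h ⟨t, Finset.mem_Iic.2 le_rfl⟩) (measurable_pi_apply _)))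
      (fun (N' : ℕ) (x : ℕ → GaugeConfig d L Circle) =>
        (((b' N' * a N' : ℕ) : ℝ)
          * replicaSEsq (fun j (x : ℕ → GaugeConfig d L Circle) =>
              (∑ i ∈ Finset.range (b' N'), f (x (b' N' * j + i))) / (b' N')) (a N') x)
        / (2 * ((∑ t ∈ Finset.range (b' N' * a N'), f (x t) ^ 2) / ((b' N' * a N' : ℕ) : ℝ)
            - ((∑ t ∈ Finset.range (b' N' * a N'), f (x t)) / ((b' N' * a N' : ℕ) : ℝ)) ^ 2)))
      atTop (fun _ => tauInt (fun t =>
        autocov (u1LeapfrogHMCN ε κ hg (fun U : GaugeConfig d L Circle => β * wilsonAction ρ U) n)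
            (wilsonMeasure (d := d) (L := L) ρ β) (fun y => f y - ∫ z, f z ∂(wilsonMeasure (d := d) (L := L) ρ β)) t
          / autocov (u1LeapfrogHMCN ε κ hg (fun U : GaugeConfig d L Circle => β * wilsonAction ρ U) n)
            (wilsonMeasure (d := d) (L := L) ρ β) (fun y => f y - ∫ z, f z ∂(wilsonMeasure (d := d) (L := L) ρ β)) 0)) := by
  haveI := isProbabilityMeasure_wilsonMeasure_circle (d := d) (L := L) ρ hρ β
  obtain ⟨hinv, ε', hε0, hε1, hmin⟩ := wilson_u1LeapfrogHMCN_certificate (d := d) (L := L) ρ hρ β hε hκ hn hg hgK hshort hb0 hb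
  exact Scoring.chain_batchMeans_tauInt_tendstoInMeasure_of_nHit hinv hmin hε0 hε1 Nat.one_pos hf hC hvar μ₀ ha hb'

end U1HMC

end Summit.Ventures.LatticeQCDFlow.Exactness

end
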